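import Literature.Computability.AlgebraicComplexity.PolynomialKoszulYoungFlatteningLeadingTerms
import Literature.Computability.AlgebraicComplexity.BDI20WidthChainProofs
import HarnessLib

/-!
# BDI Cor 6.8 (arXiv Cor 14), second strict inclusion `W̲_{4,3} ≠ B_{4,3}`: the `2 × 2`
# matrix-multiplication cubic has `ncw(p) ≤ 4 < 5 ≤ W̲R(p)` — a kernel Young-flattening certificate
(theorem-only file; cell `val-lit`, seat x6; no definitions, no named facts)

[BlaserDorflerIkenmeyer2020] Cor 14 (= CCC 2021 Cor 6.8): `W_{k,d} ⊆ W̲_{k,d} ⊆ B_{k,d} = B̲_{k,d}`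
"and there exist `k, d` for which the inclusions are strict". The printed witness of the SECOND
strict inclusion: "An example for `W̲_{k,d} ≠ B_{k,d}` is given by the `2 × 2` matrix multiplication
polynomial `p = x₁₁³ + 3x₁₁x₁₂x₂₁ + 3x₁₂x₂₂x₂₁ + x₂₂³` that is studied in [CHILO18]: We have
`ncw(p) = 4`, but `W̲R(p) ≥ 5`, which can be seen using Young flattenings … The Macaulay2 code
`loadPackage "PieriMaps"; MX = pieri({4,3,2,2},{1,2,4}, QQ[x11,x12,x21,x22]); …
rank(diff(p,MX))/rank(diff(x11^3,MX))` outputs `5`, which is the lower bound on the border Waring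
rank" (arXiv p0012.txt:L40-52; CCC p.29:13–29:14). The companion file
`BDI20WaringBorderWaringGap.lean` proves the FIRST strict inclusion (`x^{d-1} y`).

This file replaces the Macaulay2 run by a kernel-checked certificate over the tree's Koszul–Young
flattening `kyRankFin` (`PolynomialKoszulYoungFlattening*.lean`: Landsberg Prop. 8.2.1.1 /
Landsberg–Ottaviani / Farnsworth Prop. 2.4: `R̲_S(f) ≤ r ⟹ rank f^{∧p}_{k,d-k} ≤ r · binom(n-1,p)`):

* `BDI20TrCube.pderiv_trCube`, `pderiv_pderiv_trCube` — gradient and Hessian of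
  `p = x₀³ + 3x₀x₁x₂ + 3x₁x₂x₃ + x₃³` (`x₀,x₁,x₂,x₃ = x₁₁,x₁₂,x₂₁,x₂₂`).
* `BDI20TrCube.kyImage_singleton_pair`, `exists_of_kyImage_singleton_ne_zero` — the Koszul–Young
  images of the basis tensors `∂_i ⊗ e_s` (`p = k = 1`): value `ε({s},j) ∂_j∂_i f` at `e_{{j,s}}`,
  zero elsewhere (any `f`, any number of variables).
* `BDI20TrCube.thirteen_le_kyRankFin_trCube` — **`rank p^{∧1}_{1,1} ≥ 13`** over any field of
  characteristic `0`: thirteen basis tensors whose images form a TRIANGULAR family with respect to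
  the order `{0,1} < {0,2} < {1,2} < {1,3} < {2,3} < {0,3}` on `Λ²` (leading coefficients `±3x_v`,
  `±6x_v` with distinct `v` inside each leading block; the tree's `card_le_kyRankFin_of_leading_disjoint`).
  (The full rank is `15`; `13 > 4 · binom(3,1) = 12` is what the bound needs.)
* `BDI20TrCube.four_lt_borderPolyWaringRank_trCube` — **`W̲R(p) ≥ 5`** (algebraically closed,
  characteristic `0`; `lt_borderPolyWaringRank_of_mul_lt_of_isHomogeneous`).
* `BDI20TrCube.ncAbpWidthPoly_le_of_degree_three` — `ncw(f) ≤ m` for EVERY cubic in `m` variables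
  (Nisan: every cut of an order-`3` word tensor has `≤ m` rows or `≤ m` columns;
  `BDI2020.hasNcABPWidthLE_iff_wordTTRank_le`); so `ncw(p) ≤ 4`.
* `BDI2020_cor_6_8_ncw_lt_border` — the printed second strictness: `ncw(p) ≤ 4 < W̲R(p)` over `ℂ`,
  i.e. `p ∈ B_{4,3} ∖ W̲_{4,3}`; `BDI20TrCube.ncAbpWidthPoly_trCube` — `ncw(p) = 4` exactly
  (`symTensor_trCube_apply`, `four_le_rank_wordFlattening_trCube`); and the printed pair of values
  `BDI2020_cor_6_8_ncw_eq_four_border_ge_five`.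

HONEST SCOPE. `BDI2020_cor_6_8_ncw_lt_border` uses only `ncw(p) ≤ 4`; the printed value `ncw(p) = 4`
is also proved (`BDI20TrCube.ncAbpWidthPoly_trCube`: the cut-`1 | 2` flattening of the symmetric
tensor has an explicit right inverse on the columns `x₀x₀, x₀x₂, x₀x₁, x₃x₃`, hence rank `4`), and
`W̲R(p) ≥ 5` exactly as printed (`BDI2020_cor_6_8_ncw_eq_four_border_ge_five`). Typed ≠ endorsed; `VP ≠ VNP` is NOT proved and nothing here bears
on it (LADDER-VALIANT V4, row N4 "constructivity side", ideation only).

## References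
* [BlaserDorflerIkenmeyer2020] M. Bläser, J. Dörfler, C. Ikenmeyer, *On the complexity of
  evaluating highest weight vectors*, arXiv:2002.11594 = CCC 2021 (LIPIcs 200:29), Cor 14 (= CCC
  Cor 6.8) and its proof; locator paper:arxiv-2002.11594 p0012.txt:L21-52; CCC p.29:13–29:14.
* [CHILO18] L. Chiantini, J. D. Hauenstein, C. Ikenmeyer, J. M. Landsberg, G. Ottaviani,
  *Polynomials and the exponent of matrix multiplication*, Bull. LMS 50 (2018) (the cubic `tr(X³)`;
  tree: `WaringRankTrCube.lean`, where `bR_S(sM⟨2⟩) = 5` is recorded as "in print, NOT vendored" —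
  the lower bound `≥ 5` is now a theorem here).
* [LandsbergGCT2017] J. M. Landsberg, *Geometry and complexity theory*, CUP 2017, §8.2.1,
  Prop. 8.2.1.1 (Young-flattening bound); [Guan2016] Lemma 2.9 (`r₀ = binom(n-1,p)`);
  [Nisan1991] Thm. 1 (flattening ranks = ABP widths).
-/

noncomputable section

open MvPolynomial Finset
open scoped BigOperators Classical

namespace Literature.Computability.AlgebraicComplexity

namespace BDI20TrCube

open Literature.Barriers.ValiantsHypothesis (iterPDeriv iterPDeriv_nil iterPDeriv_cons)

variable {K : Type*} [Field K]

/-! ### The cubic `p = tr(X³)`, `X = (x₀ x₁ | x₂ x₃)`: gradient and Hessian -/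

/-- First partial derivatives of `p = x₀³ + 3x₀x₁x₂ + 3x₁x₂x₃ + x₃³` (the `2 × 2` matrix-multiplication cubic
`tr(X³)`, `x₀,…,x₃ = x₁₁,x₁₂,x₂₁,x₂₂`). [cite: BlaserDorflerIkenmeyer2020, Cor 14 (arXiv; = CCC 2021 Cor 6.8), proof (the polynomial `p`, p0012.txt:L40)] -/
theorem pderiv_trCube (i : Fin 4) :
    pderiv i (X 0 ^ 3 + C 3 * (X 0 * X 1 * X 2) + C 3 * (X 1 * X 2 * X 3) + X 3 ^ 3 :
        MvPolynomial (Fin 4) K) =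
      (![C 3 * X 0 ^ 2 + C 3 * (X 1 * X 2), C 3 * (X 0 * X 2) + C 3 * (X 2 * X 3),
        C 3 * (X 0 * X 1) + C 3 * (X 1 * X 3), C 3 * (X 1 * X 2) + C 3 * X 3 ^ 2] :
        Fin 4 → MvPolynomial (Fin 4) K) i := by
  have h3 : (C 3 : MvPolynomial (Fin 4) K) = 3 := map_ofNat C 3
  fin_cases i <;>
    simp only [Fin.zero_eta, Fin.mk_one, Fin.reduceFinMk, Matrix.cons_val_zero, Matrix.cons_val_one,
      Matrix.cons_val] <;>
    simp only [map_add, pderiv_C, pderiv_mul, pderiv_pow, pderiv_X_self, pderiv_X_of_ne, ne_eq,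
      Fin.reduceEq, not_false_eq_true, zero_mul, mul_zero, add_zero, zero_add, mul_one] <;>
    simp only [h3, Nat.cast_ofNat, Nat.reduceSub] <;>
    ring

/-- The Hessian of `p = x₀³ + 3x₀x₁x₂ + 3x₁x₂x₃ + x₃³` (a matrix of linear forms; its entries are the
values of the Koszul–Young flattening `p^{∧1}_{1,1}` on basis tensors). [cite: BlaserDorflerIkenmeyer2020, Cor 14 (arXiv; = CCC 2021 Cor 6.8), proof (`diff(p, MX)`, p0012.txt:L46-49)] -/
theorem pderiv_pderiv_trCube (i j : Fin 4) :
    pderiv j (pderiv i (X 0 ^ 3 + C 3 * (X 0 * X 1 * X 2) + C 3 * (X 1 * X 2 * X 3) + X 3 ^ 3 :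
        MvPolynomial (Fin 4) K)) =
      (![![C 6 * X 0, C 3 * X 2, C 3 * X 1, 0],
         ![C 3 * X 2, 0, C 3 * X 0 + C 3 * X 3, C 3 * X 2],
         ![C 3 * X 1, C 3 * X 0 + C 3 * X 3, 0, C 3 * X 1],
         ![0, C 3 * X 2, C 3 * X 1, C 6 * X 3]] : Fin 4 → Fin 4 → MvPolynomial (Fin 4) K) i j := by
  have h3 : (C 3 : MvPolynomial (Fin 4) K) = 3 := map_ofNat C 3
  have h6 : (C 6 : MvPolynomial (Fin 4) K) = 6 := map_ofNat C 6
  rw [pderiv_trCube]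
  fin_cases i <;> fin_cases j <;>
    simp only [Fin.zero_eta, Fin.mk_one, Fin.reduceFinMk, Matrix.cons_val_zero, Matrix.cons_val_one,
      Matrix.cons_val] <;>
    simp only [map_add, pderiv_C, pderiv_mul, pderiv_pow, pderiv_X_self, pderiv_X_of_ne, ne_eq,
      Fin.reduceEq, not_false_eq_true, zero_mul, mul_zero, add_zero, zero_add, mul_one] <;>
    simp only [h3, h6, Nat.cast_ofNat, Nat.reduceSub] <;>
    ring


/-! ### Koszul–Young images of basis tensors `∂_i ⊗ e_s` (`p = k = 1`) -/

/-- For a singleton `S = {s}`, the Koszul–Young image of `∂^l ⊗ e_s` at `e_{{j,s}}` (`j ≠ s`) is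
`ε({s},j) · ∂_j ∂^l f`. [cite: Guan2016, §1.3 (`Q ⊗ ω ↦ ∑_s ∂Q ⊗ l_s ∧ ω`)] -/
theorem kyImage_singleton_pair {q : ℕ} (f : MvPolynomial (Fin q) K) (l : List (Fin q)) {j s : Fin q}
    (hjs : j ≠ s) :
    kyImage f l {s} (insert j {s}) = (koszulSign {s} j : MvPolynomial (Fin q) K) * pderiv j (iterPDeriv l f) := by
  rw [kyImage_apply, Finset.sum_eq_single j]
  · rw [if_pos ⟨by simpa using hjs, rfl⟩]
  · intro j' _ hj'
    rw [if_neg]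
    rintro ⟨hj's, h⟩
    have : j' ∈ insert j ({s} : Finset (Fin q)) := by rw [h]; exact mem_insert_self _ _
    rcases mem_insert.1 this with h1 | h1
    · exact hj' h1
    · exact hj's h1
  · intro h
    exact absurd (mem_univ j) h

/-- A nonzero Koszul–Young image of `∂^l ⊗ e_s` at `e_T` forces `T = {j, s}` with `j ≠ s` and
`∂_j ∂^l f ≠ 0`. [cite: Guan2016, §1.3 (`Q ⊗ ω ↦ ∑_s ∂Q ⊗ l_s ∧ ω`)] -/
theorem exists_of_kyImage_singleton_ne_zero {q : ℕ} (f : MvPolynomial (Fin q) K) (l : List (Fin q))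
    (s : Fin q) (T : Finset (Fin q)) (h : kyImage f l {s} T ≠ 0) :
    ∃ j, j ≠ s ∧ T = insert j {s} ∧ pderiv j (iterPDeriv l f) ≠ 0 := by
  rw [kyImage_apply] at h
  obtain ⟨j, -, hj⟩ := Finset.exists_ne_zero_of_sum_ne_zero h
  refine ⟨j, ?_, ?_, ?_⟩
  · by_contra hjs
    rw [if_neg (fun hc => hc.1 (by simp [hjs]))] at hj
    exact hj rfl
  · by_contra hT
    rw [if_neg (fun hc => hT hc.2)] at hj
    exact hj rfl
  · intro hzero
    rw [hzero, mul_zero, ite_self] at hj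
    exact hj rfl

/-- The Koszul sign is a unit: its image in any field is nonzero. [folklore] -/
private theorem cast_koszulSign_ne_zero {q : ℕ} (S : Finset (Fin q)) (j : Fin q) :
    ((koszulSign S j : ℤ) : K) ≠ 0 := by
  intro h
  have h1 := congrArg (fun z : ℤ => (z : K)) (koszulSign_mul_self S j)
  simp only [Int.cast_mul, h, mul_zero, Int.cast_one] at h1
  exact zero_ne_one h1

/-! ### Thirteen triangular members: `13 ≤ rank` of the Koszul–Young flattening `p^{∧1}_{1,1}` -/

/-- The data of the thirteen basis tensors `∂_{r k} ⊗ e_{s k}` (as `(r, s, j₀, v, c)`: the leading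
pair is `{j₀, s}`, where the image is `c · x_v`), found by a search; positions of the pairs:
`{0,1} < {0,2} < {1,2} < {1,3} < {2,3} < {0,3}`. The value at the leading pair. [cite: BlaserDorflerIkenmeyer2020, Cor 14 (arXiv; = CCC 2021 Cor 6.8), proof ("which can be seen using Young flattenings … The Macaulay2 code … outputs 5")] -/
theorem kyImage_member_lead [CharZero K] (k : Fin 13) :
    kyImage (X 0 ^ 3 + C 3 * (X 0 * X 1 * X 2) + C 3 * (X 1 * X 2 * X 3) + X 3 ^ 3 : MvPolynomial (Fin 4) K)
        [(![0, 0, 0, 0, 1, 2, 3, 1, 2, 3, 1, 2, 3] : Fin 13 → Fin 4) k]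
        {(![0, 1, 2, 3, 0, 0, 0, 1, 1, 1, 2, 2, 2] : Fin 13 → Fin 4) k}
        (insert ((![2, 2, 1, 0, 3, 3, 3, 3, 3, 3, 3, 3, 3] : Fin 13 → Fin 4) k)
          {(![0, 1, 2, 3, 0, 0, 0, 1, 1, 1, 2, 2, 2] : Fin 13 → Fin 4) k}) =
      C ((![-3, -3, 3, 6, -3, -3, -6, -3, -3, -6, -3, -3, -6] : Fin 13 → K) k) *
        X ((![1, 1, 2, 0, 2, 1, 3, 2, 1, 3, 2, 1, 3] : Fin 13 → Fin 4) k) := by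
  fin_cases k <;>
    simp only [Fin.zero_eta, Fin.mk_one, Fin.reduceFinMk, Matrix.cons_val_zero, Matrix.cons_val_one,
      Matrix.cons_val] <;>
    rw [kyImage_singleton_pair _ _ (by decide), iterPDeriv_cons, iterPDeriv_nil, pderiv_pderiv_trCube] <;>
    simp only [Matrix.cons_val_zero, Matrix.cons_val_one, Matrix.cons_val, koszulSign] <;>
    simp [Finset.filter_singleton, map_neg]


/-- Triangularity of the thirteen members: the image of `∂_{r k} ⊗ e_{s k}` vanishes at every
subset `T ≠ lead k` of position `≥ pos (lead k)` (positions `{0,1} ↦ 1, {0,2} ↦ 2, {1,2} ↦ 3,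
{1,3} ↦ 4, {2,3} ↦ 5, {0,3} ↦ 6`, all other subsets `↦ 0`). [cite: BlaserDorflerIkenmeyer2020, Cor 14 (arXiv; = CCC 2021 Cor 6.8), proof (Young flattening rank)] -/
theorem kyImage_member_zero (k : Fin 13) (T : Finset (Fin 4))
    (hT : T ≠ insert ((![2, 2, 1, 0, 3, 3, 3, 3, 3, 3, 3, 3, 3] : Fin 13 → Fin 4) k)
          {(![0, 1, 2, 3, 0, 0, 0, 1, 1, 1, 2, 2, 2] : Fin 13 → Fin 4) k})
    (hle : (fun U : Finset (Fin 4) => if U = {0, 1} then 1 else if U = {0, 2} then 2 else if U = {1, 2} then 3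
        else if U = {1, 3} then 4 else if U = {2, 3} then 5 else if U = {0, 3} then 6 else (0 : ℕ))
        (insert ((![2, 2, 1, 0, 3, 3, 3, 3, 3, 3, 3, 3, 3] : Fin 13 → Fin 4) k)
          {(![0, 1, 2, 3, 0, 0, 0, 1, 1, 1, 2, 2, 2] : Fin 13 → Fin 4) k}) ≤
      (fun U : Finset (Fin 4) => if U = {0, 1} then 1 else if U = {0, 2} then 2 else if U = {1, 2} then 3
        else if U = {1, 3} then 4 else if U = {2, 3} then 5 else if U = {0, 3} then 6 else (0 : ℕ)) T) :
    kyImage (X 0 ^ 3 + C 3 * (X 0 * X 1 * X 2) + C 3 * (X 1 * X 2 * X 3) + X 3 ^ 3 : MvPolynomial (Fin 4) K)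
        [(![0, 0, 0, 0, 1, 2, 3, 1, 2, 3, 1, 2, 3] : Fin 13 → Fin 4) k]
        {(![0, 1, 2, 3, 0, 0, 0, 1, 1, 1, 2, 2, 2] : Fin 13 → Fin 4) k} T = 0 := by
  by_contra hne
  obtain ⟨j, hjs, rfl, hH⟩ := exists_of_kyImage_singleton_ne_zero _ _ _ _ hne
  rw [iterPDeriv_cons, iterPDeriv_nil, pderiv_pderiv_trCube] at hH
  fin_cases k <;> fin_cases j <;>
    simp only [Fin.zero_eta, Fin.mk_one, Fin.reduceFinMk, Fin.isValue, Matrix.cons_val_zero, Matrix.cons_val_one,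
      Matrix.cons_val] at hjs hT hle hH <;>
    first
      | exact hjs rfl
      | exact hH rfl
      | exact hT (by decide)
      | exact absurd hle (by decide)


/-- **`rank p^{∧1}_{1,1} ≥ 13`** for the Koszul–Young flattening
`S^1V^* ⊗ Λ^1V → S^1V ⊗ Λ^2V` of `p = x₀³ + 3x₀x₁x₂ + 3x₁x₂x₃ + x₃³` (the printed Macaulay2 run gives
`rank = 15 = 5 · rank(x₀³)^{∧1}_{1,1}`; thirteen triangular members suffice for `> 4 · 3`), over any
field of characteristic `0`. [cite: BlaserDorflerIkenmeyer2020, Cor 14 (arXiv; = CCC 2021 Cor 6.8), proof ("which can be seen using Young flattenings … outputs 5")] -/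
theorem thirteen_le_kyRankFin_trCube [CharZero K] :
    13 ≤ kyRankFin K 1 1
      (X 0 ^ 3 + C 3 * (X 0 * X 1 * X 2) + C 3 * (X 1 * X 2 * X 3) + X 3 ^ 3 : MvPolynomial (Fin 4) K) := by
  have hv : ∀ k k' : Fin 13, k ≠ k' →
      insert ((![2, 2, 1, 0, 3, 3, 3, 3, 3, 3, 3, 3, 3] : Fin 13 → Fin 4) k)
          ({(![0, 1, 2, 3, 0, 0, 0, 1, 1, 1, 2, 2, 2] : Fin 13 → Fin 4) k} : Finset (Fin 4)) =
        insert ((![2, 2, 1, 0, 3, 3, 3, 3, 3, 3, 3, 3, 3] : Fin 13 → Fin 4) k')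
          {(![0, 1, 2, 3, 0, 0, 0, 1, 1, 1, 2, 2, 2] : Fin 13 → Fin 4) k'} →
      (![1, 1, 2, 0, 2, 1, 3, 2, 1, 3, 2, 1, 3] : Fin 13 → Fin 4) k ≠
        (![1, 1, 2, 0, 2, 1, 3, 2, 1, 3, 2, 1, 3] : Fin 13 → Fin 4) k' := by
    decide
  have hc : ∀ k : Fin 13, (![-3, -3, 3, 6, -3, -3, -6, -3, -3, -6, -3, -3, -6] : Fin 13 → K) k ≠ 0 := by
    intro k
    fin_cases k <;> simp
  have hsupp : ∀ k : Fin 13,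
      (C ((![-3, -3, 3, 6, -3, -3, -6, -3, -3, -6, -3, -3, -6] : Fin 13 → K) k) *
          X ((![1, 1, 2, 0, 2, 1, 3, 2, 1, 3, 2, 1, 3] : Fin 13 → Fin 4) k) : MvPolynomial (Fin 4) K).support =
        {Finsupp.single ((![1, 1, 2, 0, 2, 1, 3, 2, 1, 3, 2, 1, 3] : Fin 13 → Fin 4) k) 1} := by
    intro k
    rw [C_mul_X_eq_monomial, support_monomial, if_neg (hc k)]
  have h := card_le_kyRankFin_of_leading_disjoint (K := K) (ι := Fin 13)
    (X 0 ^ 3 + C 3 * (X 0 * X 1 * X 2) + C 3 * (X 1 * X 2 * X 3) + X 3 ^ 3 : MvPolynomial (Fin 4) K)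
    (fun k => [(![0, 0, 0, 0, 1, 2, 3, 1, 2, 3, 1, 2, 3] : Fin 13 → Fin 4) k])
    (fun k => {(![0, 1, 2, 3, 0, 0, 0, 1, 1, 1, 2, 2, 2] : Fin 13 → Fin 4) k})
    (fun _ => rfl) (fun _ => card_singleton _)
    (fun k => insert ((![2, 2, 1, 0, 3, 3, 3, 3, 3, 3, 3, 3, 3] : Fin 13 → Fin 4) k)
      {(![0, 1, 2, 3, 0, 0, 0, 1, 1, 1, 2, 2, 2] : Fin 13 → Fin 4) k})
    (fun U : Finset (Fin 4) => if U = {0, 1} then 1 else if U = {0, 2} then 2 else if U = {1, 2} then 3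
        else if U = {1, 3} then 4 else if U = {2, 3} then 5 else if U = {0, 3} then 6 else (0 : ℕ))
    (fun k T hT hle => kyImage_member_zero k T hT hle)
    (fun k => by rw [kyImage_member_lead, C_mul_X_eq_monomial, Ne, monomial_eq_zero]; exact hc k)
    (fun k k' hkk' hlead => by
      rw [kyImage_member_lead, kyImage_member_lead, hsupp, hsupp, disjoint_singleton]
      exact fun h => hv k k' hkk' hlead (Finsupp.single_left_injective one_ne_zero h))
  simpa using h

/-- `p = x₀³ + 3x₀x₁x₂ + 3x₁x₂x₃ + x₃³` is a cubic form. [cite: BlaserDorflerIkenmeyer2020, Cor 14 (arXiv; = CCC 2021 Cor 6.8), proof] -/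
theorem isHomogeneous_trCube :
    (X 0 ^ 3 + C 3 * (X 0 * X 1 * X 2) + C 3 * (X 1 * X 2 * X 3) + X 3 ^ 3 : MvPolynomial (Fin 4) K).IsHomogeneous 3 := by
  have h3 : ∀ a b c : Fin 4, (C (3 : K) * (X a * X b * X c) : MvPolynomial (Fin 4) K).IsHomogeneous 3 := by
    intro a b c
    simpa using (isHomogeneous_C (Fin 4) (3 : K)).mul
      (((isHomogeneous_X K a).mul (isHomogeneous_X K b)).mul (isHomogeneous_X K c))
  exact (((isHomogeneous_X_pow (R := K) (0 : Fin 4) 3).add (h3 0 1 2)).add (h3 1 2 3)).add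
    (isHomogeneous_X_pow (R := K) (3 : Fin 4) 3)

/-- **`W̲R(p) ≥ 5`** for `p = x₀³ + 3x₀x₁x₂ + 3x₁x₂x₃ + x₃³` (the `2 × 2` matrix-multiplication cubic
`tr(X³)`), over an algebraically closed field of characteristic `0`: Landsberg's Prop. 8.2.1.1 /
Landsberg–Ottaviani Young flattening with `r₀ = rank(x₀³)^{∧1}_{1,1} = binom(3,1) = 3` and
`rank p^{∧1}_{1,1} ≥ 13 > 4 · 3` (tree: `lt_borderPolyWaringRank_of_mul_lt_of_isHomogeneous`).
[cite: BlaserDorflerIkenmeyer2020, Cor 14 (arXiv; = CCC 2021 Cor 6.8), proof ("`W̲R(p) ≥ 5`, which can be seen using Young flattenings", p0012.txt:L40-41)] -/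
theorem four_lt_borderPolyWaringRank_trCube [IsAlgClosed K] [CharZero K] :
    4 < borderPolyWaringRank 3
      (X 0 ^ 3 + C 3 * (X 0 * X 1 * X 2) + C 3 * (X 1 * X 2 * X 3) + X 3 ^ 3 : MvPolynomial (Fin 4) K) :=
  lt_borderPolyWaringRank_of_mul_lt_of_isHomogeneous 1 (by norm_num) isHomogeneous_trCube
    (lt_of_lt_of_le (by norm_num) thirteen_le_kyRankFin_trCube)

/-- Every word tensor of order `3` over `K^m` (`m ≥ 1`) has tensor-train rank `≤ m`: each cut
`a | 3 - a` has `min(a, 3-a) ≤ 1`, so the flattening has at most `m` rows or at most `m` columns.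
[cite: Nisan1991, Thm. 1] -/
theorem wordTTRank_le_of_order_three {m : ℕ} (hm : 1 ≤ m) (Ψ : (Fin 3 → Fin m) → K) : wordTTRank Ψ ≤ m := by
  refine wordTTRank_le_iff.2 fun a b h => ?_
  rcases Nat.lt_or_ge a 2 with ha | ha
  · refine (Matrix.rank_le_card_height _).trans ?_
    rw [Fintype.card_fun, Fintype.card_fin, Fintype.card_fin]
    interval_cases a
    · simpa using hm
    · simp
  · have hb : b ≤ 1 := by omega
    refine (Matrix.rank_le_card_width _).trans ?_
    rw [Fintype.card_fun, Fintype.card_fin, Fintype.card_fin]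
    interval_cases b
    · simpa using hm
    · simp

/-- **`ncw(f) ≤ m` for every cubic form in `m ≥ 1` variables** (in particular `ncw(p) ≤ 4` for the
`2 × 2` matrix-multiplication cubic), by Nisan's characterisation
(`BDI2020.hasNcABPWidthLE_iff_wordTTRank_le`). [cite: BlaserDorflerIkenmeyer2020, Prop 12 and Cor 14 (arXiv; = CCC 2021 Prop 6.6, Cor 6.8: "`ncw(p) = 4`")] -/
theorem ncAbpWidthPoly_le_of_degree_three {m : ℕ} (hm : 1 ≤ m) (f : MvPolynomial (Fin m) K) :
    BDI2020.ncAbpWidthPoly 3 f ≤ m :=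
  BDI2020.ncAbpWidth_le ((BDI2020.hasNcABPWidthLE_iff_wordTTRank_le _).2
    (wordTTRank_le_of_order_three hm _))


/-! ### `ncw(p) = 4` exactly: the cut `1 | 2` flattening of the symmetric tensor has rank `4` -/

/-- Equality of exponent vectors on `Fin 4` is decided coordinatewise. [folklore] -/
private theorem finsupp_fin4_eq_iff (f g : Fin 4 →₀ ℕ) : f = g ↔ f 0 = g 0 ∧ f 1 = g 1 ∧ f 2 = g 2 ∧ f 3 = g 3 := by
  constructor
  · rintro rfl; exact ⟨rfl, rfl, rfl, rfl⟩
  · rintro ⟨h0, h1, h2, h3⟩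
    ext i; fin_cases i <;> assumption

/-- The cubic `p` in monomial form. [cite: BlaserDorflerIkenmeyer2020, Cor 14 (arXiv; = CCC 2021 Cor 6.8), proof (the polynomial `p`, p0012.txt:L40)] -/
theorem trCube_eq_monomials :
    (X 0 ^ 3 + C 3 * (X 0 * X 1 * X 2) + C 3 * (X 1 * X 2 * X 3) + X 3 ^ 3 : MvPolynomial (Fin 4) K) =
      monomial (Finsupp.single 0 3) 1 + monomial (Finsupp.single 0 1 + Finsupp.single 1 1 + Finsupp.single 2 1) 3 +
        monomial (Finsupp.single 1 1 + Finsupp.single 2 1 + Finsupp.single 3 1) 3 + monomial (Finsupp.single 3 3) 1 := by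
  simp only [X, monomial_pow, monomial_mul, C_mul_monomial, one_pow, mul_one, Finsupp.smul_single, smul_eq_mul]

/-- The symmetric tensor of `p` at a word `w`: `coeff_{α(w)}(p) · α(w)!/3!`, unfolded.
[cite: BlaserDorflerIkenmeyer2020, §4 (arXiv p0007.txt:L11-17; = CCC p.29:7)] -/
theorem symTensor_trCube_apply [CharZero K] (w : Fin 3 → Fin 4) :
    BDI2020.symTensor 3 (X 0 ^ 3 + C 3 * (X 0 * X 1 * X 2) + C 3 * (X 1 * X 2 * X 3) + X 3 ^ 3 : MvPolynomial (Fin 4) K) w =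
      coeff (Finsupp.single (w 0) 1 + Finsupp.single (w 1) 1 + Finsupp.single (w 2) 1)
          (monomial (Finsupp.single 0 3) 1 + monomial (Finsupp.single 0 1 + Finsupp.single 1 1 + Finsupp.single 2 1) 3 +
            monomial (Finsupp.single 1 1 + Finsupp.single 2 1 + Finsupp.single 3 1) 3 + monomial (Finsupp.single 3 3) 1 :
            MvPolynomial (Fin 4) K) *
        (((((if w 0 = w 2 then 1 else 0) + (if w 1 = w 2 then 1 else 0) + 1) *
            ((if w 0 = w 1 then 1 else 0) + 1) : ℕ) : K) / 6) := by
  rw [BDI2020.symTensor, trCube_eq_monomials]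
  have hc : TableauEval.wordContent w = Finsupp.single (w 0) 1 + Finsupp.single (w 1) 1 + Finsupp.single (w 2) 1 := by
    simp [TableauEval.wordContent, Fin.sum_univ_three]
  have hff : TableauEval.ffact (Finsupp.single (w 0) 1 + Finsupp.single (w 1) 1 + Finsupp.single (w 2) 1) =
      ((if w 0 = w 2 then 1 else 0) + (if w 1 = w 2 then 1 else 0) + 1) * ((if w 0 = w 1 then 1 else 0) + 1) := by
    rw [TableauEval.ffact_add_single, TableauEval.ffact_add_single, Finsupp.add_apply, Finsupp.single_apply,
      Finsupp.single_apply, Finsupp.single_apply]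
    simp [TableauEval.ffact, Finsupp.prod_single_index]
  rw [hc, hff]
  norm_num [Nat.factorial]

/-- **`rank M_1(p) ≥ 4`**: the cut `1 | 2` flattening of the symmetric tensor of `p` has an explicit
right inverse on four columns (`(0,0) ↦ x₀`-row, `(0,2) ↦ x₁`, `(0,1) ↦ x₂`, `(3,3) ↦ x₃`), so
its four rows are independent ("We have `ncw(p) = 4`": the four first-order partials of `p` are
independent). [cite: BlaserDorflerIkenmeyer2020, Cor 14 (arXiv; = CCC 2021 Cor 6.8), proof ("We have `ncw(p) = 4`")] -/
theorem four_le_rank_wordFlattening_trCube [CharZero K] :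
    4 ≤ (wordFlattening (BDI2020.symTensor 3
      (X 0 ^ 3 + C 3 * (X 0 * X 1 * X 2) + C 3 * (X 1 * X 2 * X 3) + X 3 ^ 3 : MvPolynomial (Fin 4) K)) 1 2 rfl).rank := by
  set M := wordFlattening (BDI2020.symTensor 3
      (X 0 ^ 3 + C 3 * (X 0 * X 1 * X 2) + C 3 * (X 1 * X 2 * X 3) + X 3 ^ 3 : MvPolynomial (Fin 4) K)) 1 2 rfl with hM
  -- right inverse on the four columns `(0,0), (0,2), (0,1), (3,3)`
  let col : Fin 4 → (Fin 2 → Fin 4) := ![![0, 0], ![0, 2], ![0, 1], ![3, 3]]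
  let c : Fin 4 → K := ![1, 2, 2, 1]
  let N : Matrix (Fin 2 → Fin 4) (Fin 4) K := fun v a => if v = col a then c a else 0
  let e₁ : Fin 4 ≃ (Fin 1 → Fin 4) := (Equiv.funUnique (Fin 1) (Fin 4)).symm
  have hMN : M * N = Matrix.reindex e₁ (Equiv.refl (Fin 4)) (1 : Matrix (Fin 4) (Fin 4) K) := by
    ext u a
    obtain ⟨b, rfl⟩ : ∃ b : Fin 4, u = fun _ => b := ⟨u 0, funext fun i => by rw [Subsingleton.elim i 0]⟩
    have hsum : (M * N) (fun _ => b) a = M (fun _ => b) (col a) * c a := by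
      rw [Matrix.mul_apply]
      simp only [N, mul_ite, mul_zero, Finset.sum_ite_eq', Finset.mem_univ, if_true]
    rw [hsum, hM, wordFlattening_apply, Matrix.reindex_apply, Matrix.submatrix_apply, Equiv.refl_symm,
      Equiv.coe_refl, id, Matrix.one_apply]
    have hw : ∀ v : Fin 2 → Fin 4, (fun t : Fin 3 => Fin.append (fun _ : Fin 1 => b) v (Fin.cast (rfl : 1 + 2 = 3).symm t)) =
        ![b, v 0, v 1] := by
      intro v; funext t; fin_cases t <;> rfl
    rw [hw, symTensor_trCube_apply]
    fin_cases a <;> fin_cases b <;>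
      simp [e₁, col, c, coeff_monomial, finsupp_fin4_eq_iff] <;> norm_num
  calc 4 = (1 : Matrix (Fin 4) (Fin 4) K).rank := by rw [Matrix.rank_one, Fintype.card_fin]
    _ = (M * N).rank := by rw [hMN, Matrix.rank_reindex]
    _ ≤ M.rank := Matrix.rank_mul_le_left _ _


/-- **`ncw(p) ≥ 4`** (so `ncw(p) = 4`, as printed): every ncABP computing the symmetric tensor of
`p` has width at least the rank of the cut-`1` flattening (Nisan; `BDI2020.hasNcABPWidthLE_iff_wordTTRank_le`).
[cite: BlaserDorflerIkenmeyer2020, Cor 14 (arXiv; = CCC 2021 Cor 6.8), proof ("We have `ncw(p) = 4`")] -/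
theorem four_le_ncAbpWidthPoly_trCube [CharZero K] :
    4 ≤ BDI2020.ncAbpWidthPoly 3
      (X 0 ^ 3 + C 3 * (X 0 * X 1 * X 2) + C 3 * (X 1 * X 2 * X 3) + X 3 ^ 3 : MvPolynomial (Fin 4) K) := by
  unfold BDI2020.ncAbpWidthPoly BDI2020.ncAbpWidth
  refine le_csInf ⟨_, (BDI2020.hasNcABPWidthLE_iff_wordTTRank_le _).2 le_rfl⟩ fun w hw => ?_
  exact four_le_rank_wordFlattening_trCube.trans ((rank_wordFlattening_le_wordTTRank _ 1 2 rfl).trans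
    ((BDI2020.hasNcABPWidthLE_iff_wordTTRank_le _).1 hw))

/-- **`ncw(p) = 4`** for the `2 × 2` matrix-multiplication cubic, as printed (characteristic `0`).
[cite: BlaserDorflerIkenmeyer2020, Cor 14 (arXiv; = CCC 2021 Cor 6.8), proof ("We have `ncw(p) = 4`")] -/
theorem ncAbpWidthPoly_trCube [CharZero K] :
    BDI2020.ncAbpWidthPoly 3
      (X 0 ^ 3 + C 3 * (X 0 * X 1 * X 2) + C 3 * (X 1 * X 2 * X 3) + X 3 ^ 3 : MvPolynomial (Fin 4) K) = 4 :=
  le_antisymm (ncAbpWidthPoly_le_of_degree_three (by norm_num) _) four_le_ncAbpWidthPoly_trCube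

end BDI20TrCube

open BDI20TrCube in
/-- **BDI Cor 6.8 (arXiv Cor 14), the second strict inclusion `W̲_{k,d} ≠ B_{k,d}`**, witnessed as in
the printed proof by the `2 × 2` matrix-multiplication cubic
`p = x₁₁³ + 3x₁₁x₁₂x₂₁ + 3x₁₂x₂₂x₂₁ + x₂₂³` [CHILO18] (`k = 4`, `d = 3`; variables
`x₀,x₁,x₂,x₃ = x₁₁,x₁₂,x₂₁,x₂₂`): "We have `ncw(p) = 4`, but `W̲R(p) ≥ 5`, which can be seen using
Young flattenings" (the source's Macaulay2 certificate `rank(diff(p,MX))/rank(diff(x11^3,MX)) = 5`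
is replaced by a kernel-checked triangular family of `13 > 4·3` images of the Koszul–Young flattening
`p^{∧1}_{1,1}`). Typed: `ncw(p) ≤ 4 < W̲R(p)` over `ℂ`, for the tree's `BDI2020.ncAbpWidthPoly` /
`borderPolyWaringRank`. [cite: BlaserDorflerIkenmeyer2020, Cor 14 (arXiv; = CCC 2021 Cor 6.8), proof]
locator: paper:arxiv-2002.11594 p0012.txt:L40-52; CCC p.29:13–29:14. -/
theorem BDI2020_cor_6_8_ncw_lt_border :
    BDI2020.ncAbpWidthPoly 3
        (X 0 ^ 3 + C 3 * (X 0 * X 1 * X 2) + C 3 * (X 1 * X 2 * X 3) + X 3 ^ 3 : MvPolynomial (Fin 4) ℂ) ≤ 4 ∧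
      4 < borderPolyWaringRank 3
        (X 0 ^ 3 + C 3 * (X 0 * X 1 * X 2) + C 3 * (X 1 * X 2 * X 3) + X 3 ^ 3 : MvPolynomial (Fin 4) ℂ) :=
  ⟨ncAbpWidthPoly_le_of_degree_three (by norm_num) _, four_lt_borderPolyWaringRank_trCube⟩


open BDI20TrCube in
/-- **BDI Cor 6.8 (arXiv Cor 14), second strictness witness with the printed values**:
"We have `ncw(p) = 4`, but `W̲R(p) ≥ 5`" for the `2 × 2` matrix-multiplication cubic, over `ℂ`.
[cite: BlaserDorflerIkenmeyer2020, Cor 14 (arXiv; = CCC 2021 Cor 6.8), proof, p0012.txt:L40-41] -/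
theorem BDI2020_cor_6_8_ncw_eq_four_border_ge_five :
    BDI2020.ncAbpWidthPoly 3
        (X 0 ^ 3 + C 3 * (X 0 * X 1 * X 2) + C 3 * (X 1 * X 2 * X 3) + X 3 ^ 3 : MvPolynomial (Fin 4) ℂ) = 4 ∧
      5 ≤ borderPolyWaringRank 3
        (X 0 ^ 3 + C 3 * (X 0 * X 1 * X 2) + C 3 * (X 1 * X 2 * X 3) + X 3 ^ 3 : MvPolynomial (Fin 4) ℂ) :=
  ⟨ncAbpWidthPoly_trCube, four_lt_borderPolyWaringRank_trCube⟩

end Literature.Computability.AlgebraicComplexity
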